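import Mathlib
import HarnessLib
import Summits.RiemannHypothesis.RiemannHypothesis.Theorems.EarlyAppointmentsRemainder0XiFarLogKernelBasics
import Summits.RiemannHypothesis.RiemannHypothesis.Theorems.EarlyAppointmentsRemainder0XiFarLogKernelSubstForm
import Summits.RiemannHypothesis.RiemannHypothesis.Theorems.EarlyAppointmentsRemainder0XiFarLogKernelLogDecomp
import Summits.RiemannHypothesis.RiemannHypothesis.Theorems.EarlyAppointmentsRemainder0XiLogIntegrals
import Summits.RiemannHypothesis.RiemannHypothesis.Theorems.EarlyAppointmentsRemainder0XiTruncationHelper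
import Summits.RiemannHypothesis.RiemannHypothesis.Theorems.EarlyAppointmentsRemainder0XiFarKernelWindowBounds
import Summits.RiemannHypothesis.RiemannHypothesis.Theorems.EarlyAppointmentsRemainder0XiUpperIntegralFTC

/-! Helper for stub_farLogKernelSharp: proves farLogKernelSharp_asymptotic. -/

set_option linter.dupNamespace false
namespace Summit.RiemannHypothesis.RiemannHypothesis.Theorems.EarlyAppointmentsRemainder0Xi.ArtanhBound

open scoped Topology
open Real MeasureTheory Set Filter

open Summit.RiemannHypothesis.RiemannHypothesis.Cruxes.Remainder0Xi.Rho2V2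
open Summit.RiemannHypothesis.RiemannHypothesis.Theorems.EarlyAppointmentsRemainder0Xi
open Summit.RiemannHypothesis.RiemannHypothesis.Theorems.EarlyAppointmentsRemainder0Xi.FarKernel
open Summit.RiemannHypothesis.RiemannHypothesis.Theorems.EarlyAppointmentsRemainder0Xi.Helpers
open Summit.RiemannHypothesis.RiemannHypothesis.Theorems.EarlyAppointmentsRemainder0Xi.UpperIntegral

/-- FTC on `(a,b) ⊂ (-1,1)`. -/
theorem lower_integral_formula {a b : ℝ} (ha : -1 < a) (hab : a ≤ b) (hb : b < 1) :
    ∫ v in Ioo a b, (1 : ℝ) / (1 - v ^ 2) =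
      (1 / 2) * (Real.log (1 + b) - Real.log (1 - b)) -
      (1 / 2) * (Real.log (1 + a) - Real.log (1 - a)) := by
  have hderiv : ∀ v ∈ Set.uIcc a b,
      HasDerivAt (fun z => (1 / 2 : ℝ) * (Real.log (1 + z) - Real.log (1 - z)))
        ((1 : ℝ) / (1 - v ^ 2)) v := by
    intro v hv
    rw [Set.uIcc_of_le hab] at hv
    have h1 : 0 < 1 + v := by linarith [hv.1]
    have h2 : 0 < 1 - v := by linarith [hv.2]
    have hne3 : 1 - v ^ 2 ≠ 0 := by
      have : 1 - v ^ 2 = (1 + v) * (1 - v) := by ring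
      rw [this]; exact (mul_pos h1 h2).ne'
    have hd1 : HasDerivAt (fun z => Real.log (1 + z)) ((1 + v)⁻¹) v := by
      have hbase := Real.hasDerivAt_log h1.ne'
      have hcomp := hbase.comp v ((hasDerivAt_id v).const_add 1)
      simp only [mul_one] at hcomp
      exact hcomp
    have hd2 : HasDerivAt (fun z => Real.log (1 - z)) (-(1 - v)⁻¹) v := by
      have hbase := Real.hasDerivAt_log h2.ne'
      have hcomp := hbase.comp v ((hasDerivAt_id v).const_sub 1)
      simp only [mul_neg, mul_one] at hcomp
      exact hcomp
    have hdmul := (hd1.sub hd2).const_mul (1 / 2 : ℝ)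
    refine hdmul.congr_deriv ?_
    field_simp [h1.ne', h2.ne', hne3]
    ring
  have hcont : ContinuousOn (fun v : ℝ => (1 : ℝ) / (1 - v ^ 2)) (Set.uIcc a b) := by
    have hc : Continuous (fun v : ℝ => (1 : ℝ) - v ^ 2) := continuous_const.sub (continuous_id.pow 2)
    refine continuousOn_const.div hc.continuousOn ?_
    intro v hv
    rw [Set.uIcc_of_le hab] at hv
    have h1 : 0 < 1 + v := by linarith [hv.1]
    have h2 : 0 < 1 - v := by linarith [hv.2]
    have h12 : (1 : ℝ) - v ^ 2 = (1 + v) * (1 - v) := by ring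
    show (1 : ℝ) - v ^ 2 ≠ 0
    rw [h12]; exact (mul_pos h1 h2).ne'
  have hint : IntervalIntegrable (fun v : ℝ => (1 : ℝ) / (1 - v ^ 2)) volume a b :=
    hcont.intervalIntegrable
  rw [← MeasureTheory.integral_Ioc_eq_integral_Ioo, ← intervalIntegral.integral_of_le hab,
    intervalIntegral.integral_eq_sub_of_hasDerivAt hderiv hint]

/-- The far artanh integral in closed form. -/
theorem artanh_sum_formula {a δ : ℝ} (ha : -1 < a) (haδ : a ≤ 1 - δ) (hδ : 0 < δ) :
    (∫ v in Ioo a (1 - δ), (1 : ℝ) / (1 - v ^ 2)) + ∫ v in Ioi (1 + δ), (1 : ℝ) / (1 - v ^ 2) =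
      (1 / 2) * (Real.log (2 - δ) - Real.log (2 + δ)) -
      (1 / 2) * (Real.log (1 + a) - Real.log (1 - a)) := by
  rw [lower_integral_formula ha haδ (by linarith),
    upper_integral_formula (by linarith : (1 : ℝ) < 1 + δ)]
  have e1 : (1 : ℝ) + (1 - δ) = 2 - δ := by ring
  have e2 : (1 : ℝ) - (1 - δ) = δ := by ring
  have e3 : (1 : ℝ) + δ + 1 = 2 + δ := by ring
  have e4 : (1 : ℝ) + δ - 1 = δ := by ring
  rw [e1, e2, e3, e4]
  ring

/-- `log y − log z ≤ (y − z)/z` for positive `y, z`. -/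
theorem log_sub_log_le_div {y z : ℝ} (hz : 0 < z) (hy : 0 < y) :
    Real.log y - Real.log z ≤ (y - z) / z := by
  rw [← Real.log_div hy.ne' hz.ne']
  have h := Real.log_le_sub_one_of_pos (div_pos hy hz)
  have e : y / z - 1 = (y - z) / z := by field_simp
  linarith [h, e.le, e.ge]

/-- The closed form is small: the two artanh terms nearly cancel. -/
theorem artanh_sum_abs_le {a δ : ℝ} (ha0 : 0 ≤ a) (ha : a ≤ 1 / 2) (hδ0 : 0 < δ) (hδ : δ ≤ 1 / 4) :
    |(1 / 2) * (Real.log (2 - δ) - Real.log (2 + δ)) -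
      (1 / 2) * (Real.log (1 + a) - Real.log (1 - a))| ≤ δ + 2 * a := by
  have hp : 0 ≤ Real.log (2 + δ) - Real.log (2 - δ) := by
    have := Real.log_le_log (by linarith : (0 : ℝ) < 2 - δ) (by linarith : 2 - δ ≤ 2 + δ)
    linarith
  have hp' : Real.log (2 + δ) - Real.log (2 - δ) ≤ 2 * δ := by
    have h := log_sub_log_le_div (by linarith : (0 : ℝ) < 2 - δ) (by linarith : (0 : ℝ) < 2 + δ)
    have h' : (2 + δ - (2 - δ)) / (2 - δ) ≤ 2 * δ := by
      rw [div_le_iff₀ (by linarith : (0 : ℝ) < 2 - δ)]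
      nlinarith
    linarith
  have hq : 0 ≤ Real.log (1 + a) - Real.log (1 - a) := by
    have := Real.log_le_log (by linarith : (0 : ℝ) < 1 - a) (by linarith : 1 - a ≤ 1 + a)
    linarith
  have hq' : Real.log (1 + a) - Real.log (1 - a) ≤ 4 * a := by
    have h := log_sub_log_le_div (by linarith : (0 : ℝ) < 1 - a) (by linarith : (0 : ℝ) < 1 + a)
    have h' : (1 + a - (1 - a)) / (1 - a) ≤ 4 * a := by
      rw [div_le_iff₀ (by linarith : (0 : ℝ) < 1 - a)]
      nlinarith
    linarith
  rw [abs_le]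
  constructor <;> linarith

/-- Artanh bound: `|∫_far dv/(1−v²)| ≤ 100/x` for `x > T_PT/2`. -/
theorem artanh_integral_bound {x : ℝ} (hx : T_PT / 2 < x) :
    |(∫ v in Ioo (lowStart / x) (1 - boxHalfWidth / x), (1 : ℝ) / (1 - v ^ 2)) +
      ∫ v in Ioi (1 + boxHalfWidth / x), (1 : ℝ) / (1 - v ^ 2)| ≤ 100 / x := by
  have hx_pos := pos_of_T_PT_half_lt hx
  have ha0 : 0 ≤ lowStart / x := (div_pos (by norm_num [lowStart]) hx_pos).le
  have ha : lowStart / x ≤ 1 / 2 := lowStart_div_x_small hx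
  have hδ0 : 0 < boxHalfWidth / x := div_pos (by norm_num [boxHalfWidth]) hx_pos
  have hδ : boxHalfWidth / x ≤ 1 / 4 := boxHalfWidth_div_x_small hx
  rw [artanh_sum_formula (by linarith) (by linarith) hδ0]
  refine (artanh_sum_abs_le ha0 ha hδ0 hδ).trans ?_
  have e : boxHalfWidth / x + 2 * (lowStart / x) = (191 / 2) / x := by
    simp only [boxHalfWidth, lowStart]; ring
  rw [e]
  exact div_le_div_of_nonneg_right (by norm_num) hx_pos.le

/-- Truncation at the lower end. -/
theorem lower_truncation_error {x : ℝ} (hx : T_PT / 2 < x) :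
    |∫ v in Ioo (0 : ℝ) (lowStart / x), Real.log v / (1 - v ^ 2)| ≤
      56 * Real.log x / x := by
  have hx_pos := pos_of_T_PT_half_lt hx
  have hε_pos : 0 < lowStart / x := div_pos (by norm_num [lowStart]) hx_pos
  have hε_le : lowStart / x ≤ 1 / 2 := lowStart_div_x_small hx
  have h := truncation_bound_near_zero hε_pos hε_le
  have hx_large : 1000 < x := by linarith [T_PT_half_large]
  have hlog_expand : 1 - Real.log (lowStart / x) = 1 - Real.log 14 + Real.log x := by
    have h14ne : (14 : ℝ) ≠ 0 := by norm_num
    have hxne : x ≠ 0 := hx_pos.ne'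
    have h14 : lowStart = 14 := rfl
    rw [h14, Real.log_div h14ne hxne]
    ring
  have hlog14_gt_2 : 2 < Real.log 14 := by
    have he2 : Real.exp 2 < 14 := by
      have he1 : Real.exp 1 < 2.7182818286 := Real.exp_one_lt_d9
      calc Real.exp 2 = Real.exp 1 * Real.exp 1 := by rw [← Real.exp_add]; ring_nf
        _ < 2.7182818286 * 2.7182818286 := by nlinarith [Real.exp_pos 1]
        _ < 14 := by norm_num
    exact (Real.lt_log_iff_exp_lt (by norm_num)).mpr he2
  have hlogx_gt_1 : 1 < Real.log x := by
    have he : Real.exp 1 < 1000 := by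
      calc Real.exp 1 < 2.7182818286 := Real.exp_one_lt_d9
        _ < 1000 := by norm_num
    rw [Real.lt_log_iff_exp_lt hx_pos]
    linarith
  calc |∫ v in Ioo 0 (lowStart / x), Real.log v / (1 - v ^ 2)|
      ≤ 2 * (lowStart / x) * (1 - Real.log (lowStart / x)) := h
    _ = (2 * lowStart / x) * (1 - Real.log 14 + Real.log x) := by rw [hlog_expand]; ring
    _ ≤ (2 * lowStart / x) * (2 * Real.log x) := by
        apply mul_le_mul_of_nonneg_left _ (by positivity)
        linarith
    _ = 56 * Real.log x / x := by simp only [lowStart]; ring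

/-- The excluded window bound. -/
theorem window_error {x : ℝ} (hx : T_PT / 2 < x) :
    |∫ v in Ioo (1 - boxHalfWidth / x) (1 + boxHalfWidth / x),
        Real.log v / (1 - v ^ 2)| ≤ 135 / x := by
  have hx_pos := pos_of_T_PT_half_lt hx
  have hδ : boxHalfWidth / x ≤ 1 / 4 := boxHalfWidth_div_x_small hx
  have hδ_pos : 0 < boxHalfWidth / x := div_pos (by norm_num [boxHalfWidth]) hx_pos
  have h := excluded_window_bound hδ_pos hδ
  calc |∫ v in Ioo (1 - boxHalfWidth / x) (1 + boxHalfWidth / x), Real.log v / (1 - v ^ 2)|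
      ≤ 2 * (boxHalfWidth / x) := h
    _ = 135 / x := by simp only [boxHalfWidth]; ring

/-- The far integral differs from `−π²/4` by truncation + window errors. -/
theorem far_integral_approx {x : ℝ} (hx : T_PT / 2 < x) :
    |(∫ v in Ioo (lowStart / x) (1 - boxHalfWidth / x), Real.log v / (1 - v ^ 2)) +
     (∫ v in Ioi (1 + boxHalfWidth / x), Real.log v / (1 - v ^ 2)) -
     (-Real.pi ^ 2 / 4)| ≤ (56 * Real.log x + 135) / x := by
  have h_trunc := lower_truncation_error hx
  have h_window := window_error hx
  have hx_pos := pos_of_T_PT_half_lt hx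
  have hε_pos : 0 < lowStart / x := div_pos (by norm_num [lowStart]) hx_pos
  have hε_small : lowStart / x < 1 - boxHalfWidth / x := by
    have h1 : lowStart / x ≤ 1 / 2 := lowStart_div_x_small hx
    have h2 : boxHalfWidth / x ≤ 1 / 4 := boxHalfWidth_div_x_small hx
    linarith
  have hδ_pos : 0 < boxHalfWidth / x := div_pos (by norm_num [boxHalfWidth]) hx_pos
  have hδ_small : boxHalfWidth / x ≤ 1 / 4 := boxHalfWidth_div_x_small hx
  have h1_minus_δ_pos : 0 < 1 - boxHalfWidth / x := by linarith
  have h1_plus_δ_gt_1 : 1 < 1 + boxHalfWidth / x := by linarith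
  let f := fun v : ℝ => Real.log v / (1 - v ^ 2)
  have h_I01 := integral_log_div_one_sub_sq_Ioo_eq_neg_pi_sq_div_8
  have h_I1inf := integral_log_div_one_sub_sq_Ioi_eq_neg_pi_sq_div_8
  have hint_01 := integrableOn_log_div_Ioo
  have hint_1inf := integrableOn_log_div_Ioi
  have hint_trunc : IntegrableOn f (Ioo 0 (lowStart / x)) :=
    hint_01.mono_set (Ioo_subset_Ioo_right (by linarith [hε_small, h1_minus_δ_pos] : lowStart / x ≤ 1))
  have hint_win_left : IntegrableOn f (Ioo (1 - boxHalfWidth / x) 1) :=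
    hint_01.mono_set (Ioo_subset_Ioo (by linarith) le_rfl)
  have hint_win_right : IntegrableOn f (Ioo 1 (1 + boxHalfWidth / x)) :=
    hint_1inf.mono_set Ioo_subset_Ioi_self
  have hint_tail : IntegrableOn f (Ioi (1 + boxHalfWidth / x)) :=
    hint_1inf.mono_set (Ioi_subset_Ioi (by linarith))
  have h_window_split : ∫ v in Ioo (1 - boxHalfWidth / x) (1 + boxHalfWidth / x), f v =
      (∫ v in Ioo (1 - boxHalfWidth / x) 1, f v) + ∫ v in Ioo 1 (1 + boxHalfWidth / x), f v := by
    have hdisj : Disjoint (Ioo (1 - boxHalfWidth / x) 1) (Ioo 1 (1 + boxHalfWidth / x)) :=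
      Set.disjoint_left.2 (fun v h1 h2 => (lt_irrefl v) (h1.2.trans h2.1))
    have hae : (Ioo (1 - boxHalfWidth / x) 1 ∪ Ioo 1 (1 + boxHalfWidth / x) : Set ℝ) =ᵐ[volume]
               (Ioo (1 - boxHalfWidth / x) (1 + boxHalfWidth / x) : Set ℝ) := by
      rw [ae_eq_set]
      constructor
      · have h_subset : (Ioo (1 - boxHalfWidth / x) 1 ∪ Ioo 1 (1 + boxHalfWidth / x)) ⊆
                        Ioo (1 - boxHalfWidth / x) (1 + boxHalfWidth / x) := by
          intro v hv
          rcases hv with ⟨h1, h2⟩ | ⟨h1, h2⟩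
          · exact ⟨h1, by linarith⟩
          · exact ⟨by linarith, h2⟩
        simp only [Set.sdiff_eq_empty.mpr h_subset, measure_empty]
      · apply measure_mono_null _ (measure_singleton 1)
        intro v ⟨hv, hnv⟩
        simp only [Set.mem_union, mem_Ioo, not_or, not_and, not_lt] at hnv
        simp only [mem_Ioo] at hv
        simp only [Set.mem_singleton_iff]
        by_contra hne
        rcases (lt_or_gt_of_ne hne) with hlt | hgt
        · exact absurd (hnv.1 hv.1) (not_le.mpr hlt)
        · exact absurd hv.2 (not_lt.mpr (hnv.2 hgt))
    rw [← setIntegral_congr_set hae,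
      setIntegral_union hdisj measurableSet_Ioo hint_win_left hint_win_right]
  have h_I01_decomp : ∫ v in Ioo (lowStart / x) (1 - boxHalfWidth / x), f v =
      (∫ v in Ioo 0 1, f v) - (∫ v in Ioo 0 (lowStart / x), f v) -
        ∫ v in Ioo (1 - boxHalfWidth / x) 1, f v := by
    have h01_split : (Ioo 0 (1 - boxHalfWidth / x) : Set ℝ) ∪ Ico (1 - boxHalfWidth / x) 1 = Ioo 0 1 :=
      Ioo_union_Ico_eq_Ioo h1_minus_δ_pos (by linarith)
    have h_Ico_ae : Ico (1 - boxHalfWidth / x) 1 =ᵐ[volume] Ioo (1 - boxHalfWidth / x) 1 :=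
      Ioo_ae_eq_Ico.symm
    have hdisj1 : Disjoint (Ioo 0 (1 - boxHalfWidth / x)) (Ico (1 - boxHalfWidth / x) 1) :=
      Set.disjoint_left.2 (fun v h1 h2 => (lt_irrefl v) (h1.2.trans_le h2.1))
    have hint_01mδ : IntegrableOn f (Ioo 0 (1 - boxHalfWidth / x)) :=
      hint_01.mono_set (Ioo_subset_Ioo_right (by linarith))
    have hint_Ico : IntegrableOn f (Ico (1 - boxHalfWidth / x) 1) :=
      hint_01.mono_set (Ico_subset_Ioo (by linarith) le_rfl)
    have h01_eq : ∫ v in Ioo 0 1, f v =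
        (∫ v in Ioo 0 (1 - boxHalfWidth / x), f v) + ∫ v in Ico (1 - boxHalfWidth / x) 1, f v := by
      rw [← h01_split, setIntegral_union hdisj1 measurableSet_Ico hint_01mδ hint_Ico]
    rw [setIntegral_congr_set h_Ico_ae] at h01_eq
    have h0ε_split : Ioo 0 (lowStart / x) ∪ Ico (lowStart / x) (1 - boxHalfWidth / x) =
        Ioo 0 (1 - boxHalfWidth / x) :=
      Ioo_union_Ico_eq_Ioo hε_pos hε_small.le
    have h_Ico_ae2 : Ico (lowStart / x) (1 - boxHalfWidth / x) =ᵐ[volume]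
        Ioo (lowStart / x) (1 - boxHalfWidth / x) :=
      Ioo_ae_eq_Ico.symm
    have hdisj2 : Disjoint (Ioo 0 (lowStart / x)) (Ico (lowStart / x) (1 - boxHalfWidth / x)) :=
      Set.disjoint_left.2 (fun v h1 h2 => (lt_irrefl v) (h1.2.trans_le h2.1))
    have hint_Ico2 : IntegrableOn f (Ico (lowStart / x) (1 - boxHalfWidth / x)) :=
      hint_01.mono_set (Ico_subset_Ioo hε_pos (by linarith))
    have h01mδ_eq : ∫ v in Ioo 0 (1 - boxHalfWidth / x), f v =
        (∫ v in Ioo 0 (lowStart / x), f v) + ∫ v in Ico (lowStart / x) (1 - boxHalfWidth / x), f v := by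
      rw [← h0ε_split, setIntegral_union hdisj2 measurableSet_Ico hint_trunc hint_Ico2]
    rw [setIntegral_congr_set h_Ico_ae2] at h01mδ_eq
    linarith [h01_eq, h01mδ_eq]
  have h_I1inf_decomp : ∫ v in Ioi (1 + boxHalfWidth / x), f v =
      (∫ v in Ioi 1, f v) - ∫ v in Ioo 1 (1 + boxHalfWidth / x), f v := by
    have h_split : Ioc 1 (1 + boxHalfWidth / x) ∪ Ioi (1 + boxHalfWidth / x) = Ioi 1 :=
      Ioc_union_Ioi_eq_Ioi (by linarith)
    have hdisj : Disjoint (Ioc 1 (1 + boxHalfWidth / x)) (Ioi (1 + boxHalfWidth / x)) :=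
      Set.disjoint_left.2 (fun v h1 h2 => not_le.mpr h2 h1.2)
    have h_Ioc_ae : Ioc 1 (1 + boxHalfWidth / x) =ᵐ[volume] Ioo 1 (1 + boxHalfWidth / x) :=
      Ioo_ae_eq_Ioc.symm
    have hint_Ioc : IntegrableOn f (Ioc 1 (1 + boxHalfWidth / x)) := hint_1inf.mono_set Ioc_subset_Ioi_self
    have h1inf_eq : ∫ v in Ioi 1, f v =
        (∫ v in Ioc 1 (1 + boxHalfWidth / x), f v) + ∫ v in Ioi (1 + boxHalfWidth / x), f v := by
      rw [← h_split, setIntegral_union hdisj measurableSet_Ioi hint_Ioc hint_tail]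
    rw [setIntegral_congr_set h_Ioc_ae] at h1inf_eq
    linarith
  have h_comb : (∫ v in Ioo (lowStart / x) (1 - boxHalfWidth / x), f v) +
                (∫ v in Ioi (1 + boxHalfWidth / x), f v) =
      (-π ^ 2 / 4) - (∫ v in Ioo 0 (lowStart / x), f v) -
        ((∫ v in Ioo (1 - boxHalfWidth / x) 1, f v) + ∫ v in Ioo 1 (1 + boxHalfWidth / x), f v) := by
    rw [h_I01_decomp, h_I1inf_decomp, h_I01, h_I1inf]
    ring
  have h_window_bound' : |(∫ v in Ioo (1 - boxHalfWidth / x) 1, f v) +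
                          ∫ v in Ioo 1 (1 + boxHalfWidth / x), f v| ≤ 135 / x := by
    rw [← h_window_split]; exact h_window
  have hkey : (∫ v in Ioo (lowStart / x) (1 - boxHalfWidth / x), f v) +
              (∫ v in Ioi (1 + boxHalfWidth / x), f v) - (-π ^ 2 / 4) =
      -((∫ v in Ioo 0 (lowStart / x), f v) +
        ((∫ v in Ioo (1 - boxHalfWidth / x) 1, f v) + ∫ v in Ioo 1 (1 + boxHalfWidth / x), f v)) := by
    rw [h_comb]; ring
  calc |(∫ v in Ioo (lowStart / x) (1 - boxHalfWidth / x), f v) +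
        (∫ v in Ioi (1 + boxHalfWidth / x), f v) - (-π ^ 2 / 4)|
      = |((∫ v in Ioo 0 (lowStart / x), f v) +
         ((∫ v in Ioo (1 - boxHalfWidth / x) 1, f v) + ∫ v in Ioo 1 (1 + boxHalfWidth / x), f v))| := by
          rw [hkey, abs_neg]
    _ ≤ |∫ v in Ioo 0 (lowStart / x), f v| +
        |(∫ v in Ioo (1 - boxHalfWidth / x) 1, f v) + ∫ v in Ioo 1 (1 + boxHalfWidth / x), f v| :=
          abs_add_le _ _
    _ ≤ 56 * Real.log x / x + 135 / x := by linarith [h_trunc, h_window_bound']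
    _ = (56 * Real.log x + 135) / x := by field_simp

/-- The main integral decomposition. -/
theorem mainIntegral_decomposition {x : ℝ} (hx : T_PT / 2 < x) :
    |mainIntegral x - (1 / Real.pi) *
      ((∫ v in Ioo (lowStart / x) (1 - boxHalfWidth / x), Real.log v / (1 - v ^ 2)) +
       ∫ v in Ioi (1 + boxHalfWidth / x), Real.log v / (1 - v ^ 2))| ≤
    50 * Real.log x / x := by
  have hx_pos := pos_of_T_PT_half_lt hx
  have hx_large : 1000 < x := lt_trans T_PT_half_large hx
  have hlog_pos : 0 < Real.log x := Real.log_pos (by linarith)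
  have hA := artanh_integral_bound hx
  have hL := log_div_twoPi_bound hx_large
  rw [mainIntegral_subst_form hx, log_integral_decomposition hx]
  set L := (∫ v in Ioo (lowStart / x) (1 - boxHalfWidth / x), Real.log v / (1 - v ^ 2)) +
    ∫ v in Ioi (1 + boxHalfWidth / x), Real.log v / (1 - v ^ 2) with hLdef
  set A := (∫ v in Ioo (lowStart / x) (1 - boxHalfWidth / x), (1 : ℝ) / (1 - v ^ 2)) +
    ∫ v in Ioi (1 + boxHalfWidth / x), (1 : ℝ) / (1 - v ^ 2) with hAdef
  have e : 1 / Real.pi * (L + Real.log (x / (2 * Real.pi)) * A) - 1 / Real.pi * L =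
      (1 / Real.pi) * (Real.log (x / (2 * Real.pi)) * A) := by ring
  rw [e, abs_mul, abs_mul, abs_of_pos (by positivity : (0 : ℝ) < 1 / Real.pi)]
  have hpi : (1 : ℝ) / Real.pi ≤ 1 / 2 :=
    div_le_div_of_nonneg_left (by norm_num) (by norm_num) (by linarith [Real.pi_gt_three])
  have hprod : |Real.log (x / (2 * Real.pi))| * |A| ≤ Real.log x * (100 / x) :=
    mul_le_mul hL hA (abs_nonneg _) hlog_pos.le
  calc 1 / Real.pi * (|Real.log (x / (2 * Real.pi))| * |A|)
      ≤ (1 / 2) * (Real.log x * (100 / x)) :=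
        mul_le_mul hpi hprod (by positivity) (by norm_num)
    _ = 50 * Real.log x / x := by ring

/-- The asymptotic form: `|MAIN(x) + π/4| ≤ 191·log x/x`. -/
theorem farLogKernelSharp_asymptotic :
    Summit.RiemannHypothesis.RiemannHypothesis.Cruxes.Remainder0Xi.Rho2V2.FarLogKernelSharp := by
  intro x hx
  have hx_pos := pos_of_T_PT_half_lt hx
  have hx_large : 1000 < x := lt_trans T_PT_half_large hx
  have h_far := far_integral_approx hx
  have h_decomp := mainIntegral_decomposition hx
  have hlog_pos : 0 < Real.log x := Real.log_pos (by linarith)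
  have h_191 : (135 : ℝ) + 4 * lowStart = 191 := by norm_num [lowStart]
  have hlog_big : 2 ≤ Real.log x := by
    have h_exp2_lt : Real.exp 2 < 1000 := by
      have h1 := Real.exp_one_lt_d9
      rw [show (2 : ℝ) = 1 + 1 by norm_num, Real.exp_add]
      have hep := Real.exp_pos 1
      nlinarith
    calc 2 = Real.log (Real.exp 2) := (Real.log_exp 2).symm
      _ ≤ Real.log x := Real.log_le_log (Real.exp_pos 2) (by linarith)
  have h_bound_weaker :
      (56 * Real.log x + 135) / x + 50 * Real.log x / x ≤ Real.log x * 191 / x := by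
    rw [← add_div, mul_comm (Real.log x) 191]
    apply div_le_div_of_nonneg_right _ hx_pos.le
    nlinarith
  set I_far := (∫ v in Ioo (lowStart / x) (1 - boxHalfWidth / x), Real.log v / (1 - v ^ 2)) +
    ∫ v in Ioi (1 + boxHalfWidth / x), Real.log v / (1 - v ^ 2) with hI
  have step1 : |mainIntegral x + Real.pi / 4| ≤
      |mainIntegral x - (1 / Real.pi) * I_far| + |(1 / Real.pi) * I_far + Real.pi / 4| := by
    have h_split : mainIntegral x + Real.pi / 4 =
        (mainIntegral x - (1 / Real.pi) * I_far) + ((1 / Real.pi) * I_far + Real.pi / 4) := by ring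
    rw [h_split]
    exact abs_add_le _ _
  have h_pi_identity : (1 / Real.pi) * I_far + Real.pi / 4 =
      (1 / Real.pi) * (I_far - (-Real.pi ^ 2 / 4)) := by
    field_simp
    ring
  have step2 : |(1 / Real.pi) * I_far + Real.pi / 4| ≤ (56 * Real.log x + 135) / x := by
    rw [h_pi_identity, abs_mul, abs_of_pos (by positivity : 0 < 1 / Real.pi)]
    have hpi_le : (1 : ℝ) / Real.pi ≤ 1 := by
      rw [div_le_one Real.pi_pos]
      linarith [Real.pi_gt_three]
    calc (1 / Real.pi) * |I_far - (-Real.pi ^ 2 / 4)|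
        ≤ (1 / Real.pi) * ((56 * Real.log x + 135) / x) := by
            apply mul_le_mul_of_nonneg_left h_far; positivity
      _ ≤ 1 * ((56 * Real.log x + 135) / x) := by
            apply mul_le_mul_of_nonneg_right hpi_le; positivity
      _ = (56 * Real.log x + 135) / x := by ring
  calc |mainIntegral x + Real.pi / 4|
      ≤ |mainIntegral x - (1 / Real.pi) * I_far| + |(1 / Real.pi) * I_far + Real.pi / 4| := step1
    _ ≤ 50 * Real.log x / x + (56 * Real.log x + 135) / x := by linarith [h_decomp, step2]
    _ = (56 * Real.log x + 135) / x + 50 * Real.log x / x := by ring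
    _ ≤ Real.log x * 191 / x := h_bound_weaker
    _ = Real.log x * (135 + 4 * lowStart) / x := by rw [h_191]

end Summit.RiemannHypothesis.RiemannHypothesis.Theorems.EarlyAppointmentsRemainder0Xi.ArtanhBound
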